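import Summits.BirchSwinnertonDyer.Rank1Residual.X12.InertCoreEveryCurve
import Summits.BirchSwinnertonDyer.Rank1Residual.AdditivePotMult.RankOneHeegnerAnyPrime
import Literature.NumberTheory.EllipticCurves.ManinConstantSemistablePrimewise
import HarnessLib

/-!
# CM, analytic rank one, `p` ODD and UNRAMIFIED in the CM field, ANY reduction type at `p`,
# conductor EVEN: the upper half of `BSD(E,p)` from PUBLISHED facts — and, at a GOOD such `p`
# (Kobayashi's corner, `p = 3` included), for EVERY curve with NO Manin datum (Mazur 1978)

HONEST FRAMING (cell `b2b-bsdres`, run/shared/lean/b2b/bsd-rank1-residual/, verbatim in every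
file): the goal of the cell is to DELETE the COMBINATION-SHAPED residual classes of the
Birch–Swinnerton-Dyer formula for ALL analytic-rank `≤ 1` elliptic curves over `ℚ` — "full BSD
formula for every rank `≤ 1` curve in class `C`" assembled STRICTLY from published theorems — so
that the rank-`≤ 1` remainder becomes exactly the CONSTRUCTION-SHAPED classes, which are TYPED
(missing-input `Prop`s), NOT attempted. This is not "finishing BSD". Unit `b2b-bsdres-x1b` (X12
prover owner), generation 21; research route, no claim beyond the stated class; X12 REMAINS
CONSTRUCTION-SHAPED; nothing is booked here — booking is the lane's and the referee's.

Theorems only; no definition, no new named fact.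

## What this file adds

Gen 9 (`InertCoreUpperHalf.lean`, bad `p ≥ 5`), gen 12 (`InertBadOddPrime.lean`, bad odd `p`) and
their every-curve upgrades (gens 16/19/20) give the Euler-system (UPPER) half of `BSD(E,p)` for a CM
curve of analytic rank one at a prime `p ∣ N` unramified in the CM field. The reduction type at `p`
entered those proofs at exactly ONE place: `p ∣ N` forces `p` to SPLIT in any Heegner field `K'`
for `N`, whence `p ∤ d_{K'}` (needed for the Tamagawa comparison of the twist, eisenstein-p2's
`X2.padicValNat_tamagawaProduct_twist_of_heegner_of_odd`, and for the `p`-adic unit of the minimal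
twist model). additive-p1 observed (`AdditivePotMult/RankOneHeegnerAnyPrime.lean`) that the tree's
Friedberg–Hoffstein supply `friedbergHoffstein_exists_heegnerField_split_twist_ne_zero` produces a
Heegner field in which, IN ADDITION, any ONE given prime splits; taking that prime to be `p`
itself removes the hypothesis `p ∣ N` (`padicValRat_u_eq_zero_of_twist_minimal_of_split`). At an
odd `p` the twist's Tamagawa comparison also wants `d_{K'}` ODD; gen 12 bought this with the one
auxiliary prime (`2` split). Here the auxiliary prime is spent on `p`, and `d_{K'}` odd comes for
free whenever `2 ∣ N` (then `2` splits in every Heegner field for `N`). Every CM curve with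
`j = 1728` (`K = ℚ(i)`) has even conductor, as has every CM curve with bad reduction at `2`.

* §1 `padicValNat_shaOrder_le_of_hasCM_rankOne_of_odd_of_two_dvd` — for `W/ℚ` globally minimal,
  CM, `ord_{s=1} L(E,s) = 1`, `p ≠ 2` UNRAMIFIED in the CM field (`¬ CMRamified W p`; NO
  hypothesis on the reduction of `E` at `p`), `2 ∣ N`, and a parametrisation datum `D` at level `N`
  with `p ∤ c(D)`: `#Ш(E)_an = q ∈ ℚ` with `ord_p #Ш(E) ≤ ord_p q + 2·ord_p ∏_ℓ c_ℓ(E)`;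
  `missingUpperBoundAt_of_hasCM_rankOne_of_odd_of_two_dvd` (+ `p ∤ ∏ c_ℓ`);
  `bsdp_of_hasCM_rankOne_of_odd_of_two_dvd_of_lower` (+ the pair's own lower half);
  `bsdp_of_hasCM_rankOne_of_odd_of_two_dvd_of_shaAn_unit` — route T-KR with the curve's own datum.
* §2 AT A GOOD SUCH PRIME (`p ∤ N`: the corner the partition routes to Kobayashi 2013 Cor. 1.4,
  whose `p = 3` cells the lane holds as `T-KOB13@3` pending a primary read, x1b class ledger gen 21:
  the LAST open cell of 23 ‖ 32 ‖ 225 CM rank-one classes with `N < 10⁴ ‖ 2·10⁴ ‖ 5·10⁵`), for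
  EVERY curve: the Manin datum is DISCHARGED by Mazur 1978 Cor. 4.1 (`p` odd, `p² ∤ N ⇒ p ∤ c` for
  the strong curve, tree fact `mazur_not_dvd_maninConstant_of_odd`) on the lattice-optimal member
  `W₀ ∼ W` that Modularity supplies (`exists_isIsogenous_optimal`, gen 19), the class predicates
  moving by `CMIsogenyInvariance` and the half moving back to `W` by Cassels
  (`missingUpperBoundAt_of_isIsogenous`): `missingUpperBoundAt_of_hasCM_rankOne_of_good_odd_of_two_dvd`
  — binders = PUBLISHED named facts + the class Tamagawa datum `p ∤ ∏_ℓ c_ℓ(E')` for the members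
  `E' ∼ E` (a table datum; at `p = 3` it is NOT automatic). Then `bsdp_iff_missingLowerBoundAt_…`,
  and **route T-KR3G**: `bsdp_of_hasCM_rankOne_of_good_odd_of_two_dvd_of_shaAn_unit` — `BSD(E,p)`
  at a good odd `p ∤ d_K` of an even-conductor CM curve of analytic rank one from `r_an = 1`, a
  certified `p`-adic unit `#Ш(E)_an` and the class Tamagawa datum ALONE: no Iwasawa theory at `p`,
  no `p`-adic height, no Heegner index, no descent, no Manin table — an INDEPENDENT second basis for
  the `T-KOB13@3` cells with `2 ∣ N` (all 189 `K = ℚ(i)` classes among the 225, and the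
  even-conductor ones of the other fields), resting on read primaries only (Gross–Zagier, Kolyvagin
  in Matar–Nekovář's irreducible form, Rubin 1991 / Burungale–Flach 2024 for the rank-zero CM
  twist, Mazur 1978, Friedberg–Hoffstein, Cassels).

NOT claimed: anything at `p = 2`, at a prime ramified in the CM field, or for odd conductor (`d_{K'}`
odd and `p` split cannot both be forced from the ONE auxiliary prime of the tree's Friedberg–Hoffstein
fact; gen 12 covers odd `N` when `p ∣ N`); and nothing on the pair's own LOWER half (the typed
residue `MissingLowerBoundAt`; per pair trivial when `ord_p #Ш(E)_an = 0`). §3: at a good `p ≥ 5`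
the class Tamagawa datum is automatic (`not_dvd_tamagawaProduct_of_hasCM`).

References: [MatarNekovar2019] Thm. 0.3, §0.4, §0.11; [JetchevSkinnerWan2017] §7.4.2;
[BurungaleFlach2024] Thm. 1.1 / Cor. 2; [Rubin1991MainConj] Thm. 11.1; [Mazur1978] Cor. 4.1;
[FriedbergHoffstein1995] main theorem; [MilneADT2006] I.7.3 (Cassels); [Miller2011LMS] Def. 1.1;
HOME `b2b-bsdres-x1b/X12-ROUTE.md` §25.
-/

noncomputable section

open scoped Classical NumberField

open WeierstrassCurve NumberField Literature.NumberTheory.EllipticCurves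
  Literature.NumberTheory.EllipticCurves.ModularForms
  Literature.NumberTheory.EllipticCurves.Rank1Residual
  Literature.NumberTheory.EllipticCurves.Rank1Residual.Typed
  Literature.NumberTheory.Automorphic
  IsDedekindDomain

namespace Summit.BirchSwinnertonDyer.Rank1Residual.X12

/-! The PUBLISHED named facts of the tree used throughout (binders of every theorem below, exactly
as in `X12/InertBadOddPrime.lean`): Gross–Zagier, Kolyvagin's finiteness, Kolyvagin Cor. 13 in
Matar–Nekovář's irreducible form, GZK, modularity (two spellings), Friedberg–Hoffstein, and the
rank-zero CM formula (Rubin 1991 + Burungale–Flach 2024 = covered row C8). -/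
variable
  (hGZ : ∀ (N : ℕ) [NeZero N] (W : WeierstrassCurve ℚ) (K : Type) [Field K] [NumberField K],
    gross_zagier N W K)
  (hKo : ∀ (N : ℕ) [NeZero N] (W : WeierstrassCurve ℚ) (K : Type) [Field K] [NumberField K],
    kolyvagin N W K)
  (hMN : ∀ (N : ℕ) [NeZero N] (W : WeierstrassCurve ℚ) (K : Type) [Field K] [NumberField K],
    MatarNekovar2019.thm03_padicValNat_card_sha_le_of_irreducible N W K)
  (hGZK : rank_eq_analyticRank_of_analyticRank_le_one) (hmod : hasEntireLFunction_rat)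
  (hnf : exists_isNewformOf) (hFH : friedbergHoffstein_exists_heegnerField_split_twist_ne_zero)
  (hCM8 : bsdTriple_of_hasCM_of_L_one_ne_zero)

include hGZ hKo hMN hGZK hmod hnf hFH hCM8

/-! ### §1 Data → class: Kolyvagin's Tamagawa defect at ANY odd prime unramified in the CM field, `2 ∣ N` -/

/-- **Kolyvagin's Tamagawa defect for a CM curve of analytic rank one at ANY odd prime unramified
in the CM field, even conductor — from PUBLISHED facts only.** Let `W/ℚ` be a globally minimal CM
curve (`hCM`) with `ord_{s=1} L(E,s) = 1` and `2 ∣ N`, `p ≠ 2` a prime UNRAMIFIED in the CM field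
(`¬ CMRamified W p`; good or bad at `p`), and `D` a modular parametrisation datum of level `N_E`
with `p ∤ c(D)` (Manin datum). Then `#Ш(E)_an = q ∈ ℚ` with
`ord_p #Ш(E) ≤ ord_p q + 2·ord_p ∏_ℓ c_ℓ(E)`. Proof = gen 12's
`padicValNat_shaOrder_le_of_hasCM_rankOne_of_bad_odd` with the Friedberg–Hoffstein auxiliary prime
spent on `p` (so `p` splits in `K'`: `p ∤ d_{K'}`, and the minimal twist model's unit is `p`-adic,
additive-p1's `padicValRat_u_eq_zero_of_twist_minimal_of_split`) and `d_{K'}` odd because `2 ∣ N`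
splits in `K'`; `E[p]` irreducible (`irr_of_not_cmRamified`); the twist `E^{(d)}` is CM of analytic
rank `0`, so its LOWER half is a theorem (`missingLowerBoundAt_twist_of_hasCM`: Rubin /
Burungale–Flach); the Tamagawa `p`-valuation of the twist (eisenstein-p2's
`X2.padicValNat_tamagawaProduct_twist_of_heegner_of_odd`); multr1-p2's class-agnostic descent
`X11b.padicValNat_shaOrder_le_add_of_shaIndexBound` with Kolyvagin's bound in Matar–Nekovář's
irreducible form (`hMN`). [cite: MatarNekovar2019, Thm. 0.3, §0.4, §0.11, Cor. 5.21, Prop. 5.26 (2)]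
[cite: JetchevSkinnerWan2017, §7.4.2 (p. 31)] [cite: SilvermanATAEC1994, IV.9.4 Step 6 and Table 4.1]
[cite: BurungaleFlach2024, Thm. 1.1 and Cor. 2] [cite: Darmon2004, Thm. 3.6 and §3.7]
[cite: Miller2011LMS, Def. 1.1] -/
theorem padicValNat_shaOrder_le_of_hasCM_rankOne_of_odd_of_two_dvd
    (W : WeierstrassCurve ℚ) [W.IsElliptic] [W.IsGloballyMinimal] (p : ℕ) [Fact p.Prime]
    [NeZero (W.conductorNorm ℤ)]
    (hCM : W.HasCM) (hr : W.analyticRank = 1) (hp2 : p ≠ 2) (hnr : ¬ CMRamified W p)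
    (h2N : 2 ∣ W.conductorNorm ℤ)
    (D : ModularParametrizationData W (W.conductorNorm ℤ)) (hc : ¬ (p : ℤ) ∣ D.c) :
    ∃ q : ℚ, shaAn W = (q : ℂ) ∧
      (padicValNat p W.shaOrder : ℤ) ≤ padicValRat p q + 2 * padicValNat p W.tamagawaProduct := by
  have hp : p.Prime := Fact.out
  -- `E[p]` is irreducible: CM, `p` odd and unramified in the CM field
  have hirr : Irr W p := irr_of_not_cmRamified W p hp2 hnr
  -- the sign of the functional equation is `−1` (modularity, `r_an = 1`)
  have hw : W.rootNumber = -1 := by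
    rw [WeierstrassCurve.rootNumber_eq_neg_one_pow_analyticRank_of_exists_isNewformOf hnf W, hr]
    norm_num
  -- the auxiliary field (Friedberg–Hoffstein): every `ℓ ∣ N` split, `p` split, `|d_K'| > 4`,
  -- `L(E^{d_K'},1) ≠ 0`
  obtain ⟨K, _, _, hK, hdisc, hHN, hHp, hLt⟩ := hFH W hw p hp 4
  -- `d_K'` is odd (`2 ∣ N` splits) and prime to `p` (`p` splits)
  have hodd : Odd (NumberField.discr K) := by
    have h2 : ¬ (2 : ℤ) ∣ NumberField.discr K := by
      simpa using Literature.SatisfiesHeegnerHypothesis.not_dvd_discr hK.1 hHN Nat.prime_two h2N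
    exact Int.not_even_iff_odd.mp fun he ↦ h2 (even_iff_two_dvd.mp he)
  have hpd : ¬ (p : ℤ) ∣ NumberField.discr K :=
    Literature.SatisfiesHeegnerHypothesis.not_dvd_discr hK.1 hHp hp (dvd_refl p)
  -- `w_K' = 2`, prime to `p` odd; `d_K' ≠ −3, −4`
  have hneg : NumberField.discr K < 0 := by
    haveI : IsTotallyComplex K := hK.2
    exact discr_neg_of_finrank_eq_two K hK.1
  have h4 : NumberField.discr K < -4 := by
    have habs : ((NumberField.discr K).natAbs : ℤ) = -NumberField.discr K :=
      Int.ofNat_natAbs_of_nonpos hneg.le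
    have : (4 : ℤ) < ((NumberField.discr K).natAbs : ℤ) := by exact_mod_cast hdisc
    omega
  have hμ : ¬ p ∣ Units.torsionOrder K := by
    rw [Literature.NumberTheory.DiophantineGeometry.torsionOrder_eq_two_of_discr_lt hK.1 h4]
    intro h2
    have := Nat.le_of_dvd two_pos h2
    interval_cases p <;> simp_all
  have hD3 : NumberField.discr K ≠ -3 := by omega
  have hD4 : NumberField.discr K ≠ -4 := by omega
  -- the Heegner datum and the `K'`-rational Heegner point of the given parametrisation datum `D`
  obtain ⟨β, hβ⟩ := exists_dvd_sq_sub_discr_holds (W.conductorNorm ℤ) K hK hHN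
  obtain ⟨H, -⟩ := nonempty_heegnerDatum_holds (W.conductorNorm ℤ) K hK hβ
  obtain ⟨ι⟩ : Nonempty (K →+* ℂ) := inferInstance
  obtain ⟨P, hP⟩ := heegnerPointComplex_mem_range_map_holds (W.conductorNorm ℤ) W K hK hHN D H ι
  -- a globally minimal model of the twist
  have hD0 : (NumberField.discr K : ℚ) ≠ 0 := by exact_mod_cast NumberField.discr_ne_zero K
  haveI hEt : (W.quadraticTwist (NumberField.discr K : ℚ)).IsElliptic :=
    W.isElliptic_quadraticTwist hD0
  obtain ⟨Cd, hCd⟩ := hasGlobalMinimalModel_rat_holds (W.quadraticTwist (NumberField.discr K : ℚ))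
  haveI : (Cd • W.quadraticTwist (NumberField.discr K : ℚ)).IsGloballyMinimal := hCd
  have hWd : Cd • W.quadraticTwist (NumberField.discr K : ℚ) =
      Cd • W.quadraticTwist (NumberField.discr K : ℚ) := rfl
  -- the twist has analytic rank `0`, and — being CM of rank zero — its LOWER half is a theorem
  have hrd : (Cd • W.quadraticTwist (NumberField.discr K : ℚ)).analyticRank = 0 := by
    rw [analyticRank_smul]
    exact analyticRank_eq_zero_of_entireLFunction_one_ne_zero _ hLt
  have hlowd : MissingLowerBoundAt (Cd • W.quadraticTwist (NumberField.discr K : ℚ)) p :=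
    missingLowerBoundAt_twist_of_hasCM hCM8 hmod hGZK W hCM p hD0
      (Cd • W.quadraticTwist (NumberField.discr K : ℚ)) ⟨Cd, rfl⟩ hrd
  -- transports to the minimal twist model: irreducibility, Tamagawa `p`-valuation (odd `p ∤ d_K'`:
  -- type `I₀*` at the primes `ℓ ∣ d_K'`, all `≥ 5`), the unit (`p` splits in `K'`)
  have hirrd : (Cd • W.quadraticTwist (NumberField.discr K : ℚ)).HasIrreducibleModPGaloisRep p :=
    X11b.hasIrreducibleModPGaloisRep_twist_model W p K hK.1 hirr Cd hWd
  have htam : padicValNat p (Cd • W.quadraticTwist (NumberField.discr K : ℚ)).tamagawaProduct =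
      padicValNat p W.tamagawaProduct :=
    X2.padicValNat_tamagawaProduct_twist_of_heegner_of_odd W p hp2 K hK hodd hpd hHN Cd hWd
  have hu : padicValRat p (Cd.u : ℚ) = 0 :=
    AdditivePotMult.padicValRat_u_eq_zero_of_twist_minimal_of_split W p K hK hHp Cd hWd
  -- the twist's lower half in print shape
  obtain ⟨qd, hqd, hvqd⟩ :=
    AdditivePotMult.exists_printShape_lower_of_missingLowerBoundAt_rankZero (p := p)
      (Cd • W.quadraticTwist (NumberField.discr K : ℚ)) hGZK hrd hirrd hlowd
  -- multr1-p2's class-agnostic descent, the Kolyvagin-shape bound supplied by Matar–Nekovář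
  exact X11b.padicValNat_shaOrder_le_add_of_shaIndexBound W p (W.conductorNorm ℤ) K D H ι P
    (hGZ _ W K) (hKo _ W K) hGZK hmod hK hHN hP hp2 hc hμ hr hLt
    (Cd • W.quadraticTwist (NumberField.discr K : ℚ)) Cd hWd hu htam ⟨qd, hqd, hvqd⟩
    (fun _ hnt ↦ hMN _ W K hK hHN hD3 hD4 ⟨D, H, ι, hP⟩ hnt hp hp2 hirr)

/-- **The UPPER half for a CM curve of analytic rank one at any odd prime unramified in the CM
field, even conductor** (same hypotheses, plus `p ∤ ∏_ℓ c_ℓ(E)` — automatic for `p ≥ 5`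
(`not_dvd_tamagawaProduct_of_hasCM`), a per-pair DATUM at `p = 3`): `Typed.MissingUpperBoundAt W p`,
i.e. `ord_p #Ш(E) ≤ ord_p #Ш(E)_an`. [cite: MatarNekovar2019, Thm. 0.3 and §0.11]
[cite: BurungaleFlach2024, Thm. 1.1 and Cor. 2] [cite: Miller2011LMS, Def. 1.1] -/
theorem missingUpperBoundAt_of_hasCM_rankOne_of_odd_of_two_dvd
    (W : WeierstrassCurve ℚ) [W.IsElliptic] [W.IsGloballyMinimal] (p : ℕ) [Fact p.Prime]
    [NeZero (W.conductorNorm ℤ)]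
    (hCM : W.HasCM) (hr : W.analyticRank = 1) (hp2 : p ≠ 2) (hnr : ¬ CMRamified W p)
    (h2N : 2 ∣ W.conductorNorm ℤ)
    (D : ModularParametrizationData W (W.conductorNorm ℤ)) (hc : ¬ (p : ℤ) ∣ D.c)
    (htam : ¬ p ∣ W.tamagawaProduct) :
    MissingUpperBoundAt W p := by
  obtain ⟨q, hq, hle⟩ := padicValNat_shaOrder_le_of_hasCM_rankOne_of_odd_of_two_dvd hGZ hKo hMN
    hGZK hmod hnf hFH hCM8 W p hCM hr hp2 hnr h2N D hc
  refine ⟨q, hq, ?_⟩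
  rw [padicValNat.eq_zero_of_not_dvd htam, Nat.cast_zero, mul_zero, add_zero] at hle
  exact hle

/-- **`BSD(E,p)` for such a pair from its OWN LOWER half alone** (same hypotheses, plus
`MissingLowerBoundAt W p`). [cite: MatarNekovar2019, Thm. 0.3 and §0.11]
[cite: Miller2011LMS, §1 and Def. 1.1] -/
theorem bsdp_of_hasCM_rankOne_of_odd_of_two_dvd_of_lower
    (W : WeierstrassCurve ℚ) [W.IsElliptic] [W.IsGloballyMinimal] (p : ℕ) [Fact p.Prime]
    [NeZero (W.conductorNorm ℤ)]
    (hCM : W.HasCM) (hr : W.analyticRank = 1) (hp2 : p ≠ 2) (hnr : ¬ CMRamified W p)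
    (h2N : 2 ∣ W.conductorNorm ℤ)
    (D : ModularParametrizationData W (W.conductorNorm ℤ)) (hc : ¬ (p : ℤ) ∣ D.c)
    (htam : ¬ p ∣ W.tamagawaProduct) (hlowW : MissingLowerBoundAt W p) :
    BSDp W p :=
  bsdp_of_missingPPartAt W p hGZK (by rw [hr])
    (missingPPartAt_of_lower_of_upper W p hlowW
      (missingUpperBoundAt_of_hasCM_rankOne_of_odd_of_two_dvd hGZ hKo hMN hGZK hmod hnf hFH hCM8 W p
        hCM hr hp2 hnr h2N D hc htam))

/-- **Route T-KR with the curve's own datum** (same hypotheses): `BSD(E,p)` from `p ∤ c(D)`,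
`p ∤ ∏c_ℓ`, `2 ∣ N` and a certified `p`-adic unit `#Ш(E)_an = q`: the upper half gives
`ord_p #Ш(E) ≤ ord_p q = 0`. No Heegner index, no descent.
[cite: MatarNekovar2019, Thm. 0.3 and §0.11] [cite: Miller2011LMS, §1 and Def. 1.1] -/
theorem bsdp_of_hasCM_rankOne_of_odd_of_two_dvd_of_shaAn_unit
    (W : WeierstrassCurve ℚ) [W.IsElliptic] [W.IsGloballyMinimal] (p : ℕ) [Fact p.Prime]
    [NeZero (W.conductorNorm ℤ)]
    (hCM : W.HasCM) (hr : W.analyticRank = 1) (hp2 : p ≠ 2) (hnr : ¬ CMRamified W p)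
    (h2N : 2 ∣ W.conductorNorm ℤ)
    (D : ModularParametrizationData W (W.conductorNorm ℤ)) (hc : ¬ (p : ℤ) ∣ D.c)
    (htam : ¬ p ∣ W.tamagawaProduct) {q : ℚ} (hq : shaAn W = (q : ℂ))
    (hv : padicValRat p q = 0) : BSDp W p :=
  bsdp_of_hasCM_rankOne_of_odd_of_two_dvd_of_lower hGZ hKo hMN hGZK hmod hnf hFH hCM8 W p hCM hr hp2
    hnr h2N D hc htam (missingLowerBoundAt_of_shaAn_unit hq hv)

/-! ### §2 At a GOOD odd `p ∤ d_K` (Kobayashi's corner, `p = 3` included), `2 ∣ N`: EVERY curve, NO Manin datum (Mazur 1978) -/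

omit hGZ hKo hMN hGZK hmod hnf hFH hCM8 in
/-- **Mazur 1978 Cor. 4.1 on the strong member at a GOOD odd prime**: for `W₀/ℚ` globally minimal
with a LATTICE-OPTIMAL datum `D₀` at the conductor level and an odd prime `p ∤ N`: `p ∤ c(D₀)`.
[cite: Mazur1978, Cor. 4.1] -/
theorem not_dvd_maninConstant_of_optimal_of_good_odd
    (hMazur : mazur_not_dvd_maninConstant_of_odd)
    (W₀ : WeierstrassCurve ℚ) [W₀.IsElliptic] [W₀.IsGloballyMinimal] [NeZero (W₀.conductorNorm ℤ)]
    (p : ℕ) [Fact p.Prime] (hp2 : p ≠ 2) (hpN : ¬ p ∣ W₀.conductorNorm ℤ)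
    (D₀ : ModularParametrizationData W₀ (W₀.conductorNorm ℤ))
    (hopt : ∀ z ∈ D₀.L.lattice, ∃ w ∈ periodLattice D₀.f, z = D₀.c * w) :
    ¬ (p : ℤ) ∣ D₀.c :=
  hMazur W₀ D₀ hopt p Fact.out hp2 (fun h ↦ hpN (dvd_trans (dvd_pow_self p two_ne_zero) h))

/-- **CM, ANALYTIC RANK ONE, GOOD ODD `p` UNRAMIFIED IN THE CM FIELD, EVEN CONDUCTOR — EVERY CURVE:
THE UPPER HALF OF `BSD(E,p)` FROM PUBLISHED FACTS + the class Tamagawa datum.** For EVERY globally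
minimal `W/ℚ` with CM, `ord_{s=1} L(E,s) = 1`, `2 ∣ N`, `p ≠ 2`, `p ∤ N` (`Good W p`),
`¬ CMRamified W p`, such that `p ∤ ∏_ℓ c_ℓ(E')` for every globally minimal `E' ∼ E` over `ℚ`
(`htam`; a TABLE datum of the isogeny class — at `p ≥ 5` it is automatic, at `p = 3` not):
`MissingUpperBoundAt W p`. Proof: Modularity supplies a member `W₀ ∼ W` with a lattice-optimal
datum `D₀` at level `N_{W₀} = N_W` (`exists_isIsogenous_optimal`); Mazur's Cor. 4.1 (`hMazur`)
gives `p ∤ c(D₀)`; CM / `r_an` / the CM field are isogeny invariants (`CMIsogenyInvariance`);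
§1 gives the half for `W₀`; Cassels (`hCassels`) moves it to `W`. NO Manin datum, NO optimality
hypothesis on `W`, NO identification of the strong curve. [cite: Mazur1978, Cor. 4.1]
[cite: MatarNekovar2019, Thm. 0.3 and §0.11] [cite: BurungaleFlach2024, Thm. 1.1 and Cor. 2]
[cite: MilneADT2006, Thm. I.7.3 and Remark I.7.4] [cite: PastenShimura2024, §2 p. 12] -/
theorem missingUpperBoundAt_of_hasCM_rankOne_of_good_odd_of_two_dvd
    (hMazur : mazur_not_dvd_maninConstant_of_odd) (hCassels : bsdRHS_eq_of_isIsogenous)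
    (W : WeierstrassCurve ℚ) [W.IsElliptic] [W.IsGloballyMinimal] (p : ℕ) [Fact p.Prime]
    (hCM : W.HasCM) (hr : W.analyticRank = 1) (hp2 : p ≠ 2) (hgood : Good W p)
    (hnr : ¬ CMRamified W p) (h2N : 2 ∣ W.conductorNorm ℤ)
    (htam : ∀ (W' : WeierstrassCurve ℚ) [W'.IsElliptic] [W'.IsGloballyMinimal],
      IsIsogenous W W' → ¬ p ∣ W'.tamagawaProduct) :
    MissingUpperBoundAt W p := by
  obtain ⟨W₀, hE₀, hM₀, hN₀, D₀, hiso, hN, hopt⟩ := exists_isIsogenous_optimal hnf W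
  have hpN : ¬ p ∣ W.conductorNorm ℤ := fun h ↦
    ((W.dvd_conductorNorm_iff_not_hasGoodReductionAtPrime p).mp h) hgood
  have hpN₀ : ¬ p ∣ W₀.conductorNorm ℤ := by rw [hN]; exact hpN
  have h2N₀ : 2 ∣ W₀.conductorNorm ℤ := by rw [hN]; exact h2N
  have hCM₀ : W₀.HasCM := hasCM_of_isIsogenous hiso hCM
  have hr₀ : W₀.analyticRank = 1 := (analyticRank_eq_of_isIsogenous' hiso) ▸ hr
  have hnr₀ : ¬ CMRamified W₀ p := fun h ↦ hnr ((cmRamified_iff_of_isIsogenous hiso hCM p).mpr h)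
  have hc₀ : ¬ (p : ℤ) ∣ D₀.c :=
    not_dvd_maninConstant_of_optimal_of_good_odd hMazur W₀ p hp2 hpN₀ D₀ hopt
  have hup₀ : MissingUpperBoundAt W₀ p :=
    missingUpperBoundAt_of_hasCM_rankOne_of_odd_of_two_dvd hGZ hKo hMN hGZK hmod hnf hFH hCM8 W₀ p
      hCM₀ hr₀ hp2 hnr₀ h2N₀ D₀ hc₀ (htam W₀ hiso)
  exact missingUpperBoundAt_of_isIsogenous hCassels hiso (hGZK W₀ (by rw [hr₀])).2
    (W₀.leadingLCoeff_ne_zero_holds (hmod W₀)) hup₀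

/-- **`BSD(E,p)` for every such curve from the curve's OWN LOWER half alone.**
[cite: Mazur1978, Cor. 4.1] [cite: MatarNekovar2019, Thm. 0.3 and §0.11] -/
theorem bsdp_of_hasCM_rankOne_of_good_odd_of_two_dvd_of_lower
    (hMazur : mazur_not_dvd_maninConstant_of_odd) (hCassels : bsdRHS_eq_of_isIsogenous)
    (W : WeierstrassCurve ℚ) [W.IsElliptic] [W.IsGloballyMinimal] (p : ℕ) [Fact p.Prime]
    (hCM : W.HasCM) (hr : W.analyticRank = 1) (hp2 : p ≠ 2) (hgood : Good W p)
    (hnr : ¬ CMRamified W p) (h2N : 2 ∣ W.conductorNorm ℤ)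
    (htam : ∀ (W' : WeierstrassCurve ℚ) [W'.IsElliptic] [W'.IsGloballyMinimal],
      IsIsogenous W W' → ¬ p ∣ W'.tamagawaProduct)
    (hlow : MissingLowerBoundAt W p) : BSDp W p :=
  bsdp_of_missingPPartAt W p hGZK (by rw [hr])
    (missingPPartAt_of_lower_of_upper W p hlow
      (missingUpperBoundAt_of_hasCM_rankOne_of_good_odd_of_two_dvd hGZ hKo hMN hGZK hmod hnf hFH hCM8
        hMazur hCassels W p hCM hr hp2 hgood hnr h2N htam))

/-- **For every such curve: `BSD(E,p) ⟺ MissingLowerBoundAt W p`** — the residue at a good odd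
`p ∤ d_K` of an even-conductor CM curve of analytic rank one is exactly the main-conjecture half.
[cite: Mazur1978, Cor. 4.1] [cite: MatarNekovar2019, Thm. 0.3 and §0.11]
[cite: Miller2011LMS, §1 and Def. 1.1] -/
theorem bsdp_iff_missingLowerBoundAt_of_hasCM_rankOne_of_good_odd_of_two_dvd
    (hMazur : mazur_not_dvd_maninConstant_of_odd) (hCassels : bsdRHS_eq_of_isIsogenous)
    (W : WeierstrassCurve ℚ) [W.IsElliptic] [W.IsGloballyMinimal] (p : ℕ) [Fact p.Prime]
    (hCM : W.HasCM) (hr : W.analyticRank = 1) (hp2 : p ≠ 2) (hgood : Good W p)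
    (hnr : ¬ CMRamified W p) (h2N : 2 ∣ W.conductorNorm ℤ)
    (htam : ∀ (W' : WeierstrassCurve ℚ) [W'.IsElliptic] [W'.IsGloballyMinimal],
      IsIsogenous W W' → ¬ p ∣ W'.tamagawaProduct) :
    BSDp W p ↔ MissingLowerBoundAt W p := by
  refine ⟨fun hb ↦ ?_, fun hlow ↦ ?_⟩
  · haveI : Finite W.sha := (hGZK W (by rw [hr])).2
    exact (lower_and_upper_of_missingPPartAt W p (missingPPartAt_of_bsdp W p hb)).1
  · exact bsdp_of_hasCM_rankOne_of_good_odd_of_two_dvd_of_lower hGZ hKo hMN hGZK hmod hnf hFH hCM8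
      hMazur hCassels W p hCM hr hp2 hgood hnr h2N htam hlow

/-- **ROUTE T-KR3G — `BSD(E,p)` at a GOOD odd `p ∤ d_K` for EVERY even-conductor CM curve of
analytic rank one, from `r_an = 1`, a certified `p`-adic unit `#Ш(E)_an = q` and the class
Tamagawa datum ALONE.** No Iwasawa theory at `p`, no `p`-adic height, no Heegner index, no descent,
no Manin table, no optimality: the upper half (Kolyvagin–Matar–Nekovář over a Friedberg–Hoffstein
field, the rank-zero CM twist by Rubin / Burungale–Flach, Mazur's Cor. 4.1 on the strong member,
Cassels) gives `ord_p #Ш(E) ≤ ord_p q = 0 ≤ ord_p #Ш(E)`. An independent second basis for the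
cells the partition routes to Kobayashi 2013 Cor. 1.4 at `p = 3` (lane row `T-KOB13@3`, held).
[cite: Mazur1978, Cor. 4.1] [cite: MatarNekovar2019, Thm. 0.3 and §0.11]
[cite: BurungaleFlach2024, Thm. 1.1 and Cor. 2] [cite: Miller2011LMS, §1 and Def. 1.1] -/
theorem bsdp_of_hasCM_rankOne_of_good_odd_of_two_dvd_of_shaAn_unit
    (hMazur : mazur_not_dvd_maninConstant_of_odd) (hCassels : bsdRHS_eq_of_isIsogenous)
    (W : WeierstrassCurve ℚ) [W.IsElliptic] [W.IsGloballyMinimal] (p : ℕ) [Fact p.Prime]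
    (hCM : W.HasCM) (hr : W.analyticRank = 1) (hp2 : p ≠ 2) (hgood : Good W p)
    (hnr : ¬ CMRamified W p) (h2N : 2 ∣ W.conductorNorm ℤ)
    (htam : ∀ (W' : WeierstrassCurve ℚ) [W'.IsElliptic] [W'.IsGloballyMinimal],
      IsIsogenous W W' → ¬ p ∣ W'.tamagawaProduct)
    {q : ℚ} (hq : shaAn W = (q : ℂ)) (hv : padicValRat p q = 0) : BSDp W p :=
  bsdp_of_hasCM_rankOne_of_good_odd_of_two_dvd_of_lower hGZ hKo hMN hGZK hmod hnf hFH hCM8 hMazur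
    hCassels W p hCM hr hp2 hgood hnr h2N htam (missingLowerBoundAt_of_shaAn_unit hq hv)

/-! ### §3 At a GOOD `p ≥ 5` unramified in the CM field, `2 ∣ N`: EVERY curve, no datum at all -/

/-- **CM, analytic rank one, GOOD `p ≥ 5` unramified in the CM field, even conductor — EVERY curve:
the upper half of `BSD(E,p)` from PUBLISHED facts ALONE** (the class Tamagawa datum of §2 is
automatic at `p ≥ 5`: every bad prime of a CM curve is additive with `c_ℓ ≤ 4`,
`not_dvd_tamagawaProduct_of_hasCM` applied to each member, which is CM by `hasCM_of_isIsogenous`).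
[cite: Mazur1978, Cor. 4.1] [cite: MatarNekovar2019, Thm. 0.3 and §0.11]
[cite: SilvermanATAEC1994, Cor. IV.9.2(d)] [cite: MilneADT2006, Thm. I.7.3 and Remark I.7.4] -/
theorem missingUpperBoundAt_of_hasCM_rankOne_of_good_of_five_le_of_two_dvd
    (hMazur : mazur_not_dvd_maninConstant_of_odd) (hCassels : bsdRHS_eq_of_isIsogenous)
    (W : WeierstrassCurve ℚ) [W.IsElliptic] [W.IsGloballyMinimal] (p : ℕ) [Fact p.Prime]
    (hCM : W.HasCM) (hr : W.analyticRank = 1) (hp5 : 5 ≤ p) (hgood : Good W p)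
    (hnr : ¬ CMRamified W p) (h2N : 2 ∣ W.conductorNorm ℤ) : MissingUpperBoundAt W p :=
  missingUpperBoundAt_of_hasCM_rankOne_of_good_odd_of_two_dvd hGZ hKo hMN hGZK hmod hnf hFH hCM8
    hMazur hCassels W p hCM hr (by omega) hgood hnr h2N
    (fun W' _ _ hiso ↦ not_dvd_tamagawaProduct_of_hasCM W' (hasCM_of_isIsogenous hiso hCM) p hp5)

/-- **Route T-KR at a GOOD `p ≥ 5` unramified in the CM field for EVERY even-conductor CM curve of
analytic rank one: `BSD(E,p)` from `r_an = 1` and a certified `p`-adic unit `#Ш(E)_an` ALONE.**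
[cite: Mazur1978, Cor. 4.1] [cite: MatarNekovar2019, Thm. 0.3 and §0.11]
[cite: BurungaleFlach2024, Thm. 1.1 and Cor. 2] [cite: Miller2011LMS, §1 and Def. 1.1] -/
theorem bsdp_of_hasCM_rankOne_of_good_of_five_le_of_two_dvd_of_shaAn_unit
    (hMazur : mazur_not_dvd_maninConstant_of_odd) (hCassels : bsdRHS_eq_of_isIsogenous)
    (W : WeierstrassCurve ℚ) [W.IsElliptic] [W.IsGloballyMinimal] (p : ℕ) [Fact p.Prime]
    (hCM : W.HasCM) (hr : W.analyticRank = 1) (hp5 : 5 ≤ p) (hgood : Good W p)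
    (hnr : ¬ CMRamified W p) (h2N : 2 ∣ W.conductorNorm ℤ)
    {q : ℚ} (hq : shaAn W = (q : ℂ)) (hv : padicValRat p q = 0) : BSDp W p :=
  bsdp_of_hasCM_rankOne_of_good_odd_of_two_dvd_of_shaAn_unit hGZ hKo hMN hGZK hmod hnf hFH hCM8
    hMazur hCassels W p hCM hr (by omega) hgood hnr h2N
    (fun W' _ _ hiso ↦ not_dvd_tamagawaProduct_of_hasCM W' (hasCM_of_isIsogenous hiso hCM) p hp5)
    hq hv

end Summit.BirchSwinnertonDyer.Rank1Residual.X12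

end
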